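import Mathlib

/-!
# A-priori resolvent bounds under a relatively bounded perturbation

Kernel for the tail-absorption step of the monodromy-box certificate (solo-blind programme,
PLAN §96(t)–(v)): if the truncated period map `M` has the a-priori bound
`‖x‖ ≤ K ‖x - M x‖` (i.e. `‖(1 - M)⁻¹‖ ≤ K` in a-priori form) and the coupling defect `Δ`
coming from the discarded modes satisfies `‖Δ x‖ ≤ η ‖x‖` with `K η < 1`, then the full head
block `M + Δ` has the a-priori bound `‖x‖ ≤ K / (1 - K η) · ‖x - M x - Δ x‖`.  Stated over a
seminormed group with the images `M x`, `Δ x` as free vectors, so that it applies verbatim to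
matrices, bounded operators and unbounded period maps alike.
-/

namespace Summit.AnomalousDissipation.AnomalousDissipation.Theorems

variable {E : Type*} [SeminormedAddCommGroup E]

/-- A-priori bound for a relatively bounded perturbation: `‖x‖ ≤ K‖x - Mx‖`, `‖Δx‖ ≤ η‖x‖`,
`Kη < 1` give `‖x‖ ≤ K/(1 - Kη) · ‖x - Mx - Δx‖`. -/
theorem apriori_perturbation {K η : ℝ} (hK : 0 ≤ K) (hKη : K * η < 1) {x Mx Δx : E}
    (hA : ‖x‖ ≤ K * ‖x - Mx‖) (hΔ : ‖Δx‖ ≤ η * ‖x‖) :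
    ‖x‖ ≤ K / (1 - K * η) * ‖x - Mx - Δx‖ := by
  have hpos : 0 < 1 - K * η := by linarith
  have htri : ‖x - Mx‖ ≤ ‖x - Mx - Δx‖ + ‖Δx‖ := by
    have h := norm_add_le (x - Mx - Δx) Δx
    simpa using h
  have h1 : ‖x‖ ≤ K * ‖x - Mx - Δx‖ + K * η * ‖x‖ := by
    calc ‖x‖ ≤ K * ‖x - Mx‖ := hA
      _ ≤ K * (‖x - Mx - Δx‖ + ‖Δx‖) := mul_le_mul_of_nonneg_left htri hK
      _ ≤ K * (‖x - Mx - Δx‖ + η * ‖x‖) := by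
          apply mul_le_mul_of_nonneg_left _ hK
          exact add_le_add le_rfl hΔ
      _ = K * ‖x - Mx - Δx‖ + K * η * ‖x‖ := by ring
  have h2 : (1 - K * η) * ‖x‖ ≤ K * ‖x - Mx - Δx‖ := by nlinarith
  rw [div_mul_eq_mul_div, le_div_iff₀ hpos]
  linarith

/-- Absolute-defect version: `‖x‖ ≤ K‖x - Mx‖` and `‖Δx‖ ≤ δ` give
`‖x‖ ≤ K (‖x - Mx - Δx‖ + δ)`. -/
theorem apriori_perturbation_abs {K δ : ℝ} (hK : 0 ≤ K) {x Mx Δx : E}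
    (hA : ‖x‖ ≤ K * ‖x - Mx‖) (hΔ : ‖Δx‖ ≤ δ) :
    ‖x‖ ≤ K * (‖x - Mx - Δx‖ + δ) := by
  have htri : ‖x - Mx‖ ≤ ‖x - Mx - Δx‖ + ‖Δx‖ := by
    have h := norm_add_le (x - Mx - Δx) Δx
    simpa using h
  calc ‖x‖ ≤ K * ‖x - Mx‖ := hA
    _ ≤ K * (‖x - Mx - Δx‖ + ‖Δx‖) := mul_le_mul_of_nonneg_left htri hK
    _ ≤ K * (‖x - Mx - Δx‖ + δ) := by
        apply mul_le_mul_of_nonneg_left _ hK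
        exact add_le_add le_rfl hΔ

/-- Two-sided head/tail closing in a-priori form: if the head block has `‖x‖ ≤ K‖x - Mx‖`, the
defect is relatively bounded by `η` with `Kη < 1`, then with `K' = K/(1 - Kη)` the perturbed head
satisfies the hypothesis `‖x‖ ≤ K' ‖x - (Mx + Δx)‖` consumed by `schur_apriori_fst/snd`. -/
theorem apriori_perturbation' {K η : ℝ} (hK : 0 ≤ K) (hKη : K * η < 1) {x Mx Δx : E}
    (hA : ‖x‖ ≤ K * ‖x - Mx‖) (hΔ : ‖Δx‖ ≤ η * ‖x‖) :
    ‖x‖ ≤ K / (1 - K * η) * ‖x - (Mx + Δx)‖ := by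
  have h := apriori_perturbation hK hKη hA hΔ
  simpa [sub_sub] using h

end Summit.AnomalousDissipation.AnomalousDissipation.Theorems
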